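import Literature.MathematicalPhysics.QuantumFieldTheory.Balaban1983to89.T4AveragingDisintegration
import HarnessLib

/-!
# Crux `FluctuationComparisonRegPrIntL` (stmt-QuantumFields-20520, rung R3), PATH-B organ, v18 (H-currency): BRICK 2b —
# THE FIBRE-MEAN SQUARE KNIT: the second difference of a normalised fibre mean = PULL-BACK + two CROSS covariances + CENTRED × second RN-variation
# (the LINᵘ-H analogue of the Jensen knit; abstract measure theory, DEFINITION-FREE)

Cell `ym3-torus` (YM ladder rung R3 = continuum `SU(2)` Yang–Mills on the three-torus — a RUNG: NOT d = 4, NOT infinite volume, NOT a mass gap, NOT Clay).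
LEAD-20520 width seat `ym-ust-20520-w3` (gen 25), BRICK 2b of the O1ᵘ-H v2 reduction (after ✓p804070 BRICK 1 «Taylor cut», ✓p805782 BRICK 2a «pull-back along
displacement paths»); `--kind proof --supports stmt-QuantumFields-20520 --as helper`, count-neutral, no registry ∕ binder ∕ `Lines/` edit, default heartbeats.

WHAT THIS IS.  LINᵘ-H (BRICK 1's `hL`) presents the m-step localised fibre mean `mfun(V) = ∫ h_{Ts} dP_V` of the seed discrepancy under the reference tower's
conditional law.  Along a fibre-respecting transport `T_V` (w5 g22 FINDING §6.4) the four corners of a coarse one-bond-pair square read, on ONE fibre `(Ω, P)`,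
`m_ab = ∫ F_ab·ŵ_ab dP` with `F_ab := h_{Ts} ∘ T_{V_ab}` and NORMALISED weights `ŵ_ab` (`∫ ŵ_ab dP = 1`; = RN factor × pulled-back cut-off × reference density).  This
file is the EXACT KNIT of the square (★★`fibreMean_secondDiff_eq`, any constants `c₁ c₂ c₀`):
`m₁₁ − m₁₀ − m₀₁ + m₀₀ = ∫ (F₁₁ − F₁₀ − F₀₁ + F₀₀)·ŵ₁₁ + ∫ (F₁₀ − F₀₀ − c₁)·(ŵ₁₁ − ŵ₁₀) + ∫ (F₀₁ − F₀₀ − c₂)·(ŵ₁₁ − ŵ₀₁) + ∫ (F₀₀ − c₀)·(ŵ₁₁ − ŵ₁₀ − ŵ₀₁ + ŵ₀₀)`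
— PULL-BACK (the ξ-wise second difference of `h ∘ T`, BRICK 2a) · two CROSS terms (first difference of `F` centred by `cᵢ` × FIRST variation of the weights) · CENTRED
`F₀₀ − c₀` × SECOND variation of the weights — and its triangle-inequality reading ★`abs_fibreMean_secondDiff_le`:
`|ΔΔ m| ≤ A + B₁·∫|ŵ₁₁ − ŵ₁₀| + B₂·∫|ŵ₁₁ − ŵ₀₁| + B₀·∫|ŵ₁₁ − ŵ₁₀ − ŵ₀₁ + ŵ₀₀|` from sup bounds `|ΔΔF| ≤ A`, `|F₁₀ − F₀₀ − c₁| ≤ B₁`, `|F₀₁ − F₀₀ − c₂| ≤ B₂`,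
`|F₀₀ − c₀| ≤ B₀` and `ŵ₁₁ ≥ 0`.  So LINᵘ-H's letters split into FOUR NAMED CHANNELS: the pulled-back clause (2a's `k_c = C·XᵀkX + gᵀY`), two products «gradient
oscillation across the fibre × RN first-variation letter», and «fibre oscillation × RN second-variation letter» — the last three are where the reference measure's
decoupling (cluster expansion, [Balaban1987RG1] Thm 1 ∕ Thm 3, lit `B12`) and the background regularity ([Balaban1985Variational] Thm 1 ∕ Prop 9, lit `B11`) must enter;
NOTHING of that is here.  (Sup-oscillation bounds are the crude reading; a variance∕Brascamp–Lieb reading of the same three integrals is the JVARᵘ-H-type road — ideator №11.)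

HONEST FRAMING: an integral identity and a triangle inequality over HYPOTHESIS data; nothing of Bałaban's analysis is asserted or proved; the transport `T`, the
weights and every letter for the runs' towers are NOT constructed; LINᵘ-H ∕ JVARᵘ-H ∕ O1ᵘ-H v2 ∕ S1aᴴ ∕ 26243 ∕ S2α′ ∕ S2β OPEN; crux 20520 `FluctuationComparisonRegPrIntL` ∕
`YM3TorusSU2` NOT proved; no summit ∕ sub-problem statement is proved; rung R3 = SU(2) YM₃ on T³ at fixed lattice data — NOT d = 4, NOT infinite volume, NOT a mass gap,
NOT Clay; the Yang–Mills mass gap is NOT proved.  [folklore] measure-theoretic bookkeeping.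
-/

set_option autoImplicit false

noncomputable section

namespace Summit.QuantumFields.YangMills.Theorems.OrganTangentFibreMeanSquareKnit

open MeasureTheory

variable {Ω : Type*} [MeasurableSpace Ω]

/-- A bounded a.e.-strongly-measurable factor times an integrable one is integrable (argument order of this file). [folklore] -/
theorem integrable_bdd_mul {P : Measure Ω} {F w : Ω → ℝ} {M : ℝ}
    (hFm : AEStronglyMeasurable F P) (hFb : ∀ ξ, |F ξ| ≤ M) (hw : Integrable w P) :
    Integrable (fun ξ => F ξ * w ξ) P := by
  refine hw.bdd_mul (c := M) hFm (Filter.Eventually.of_forall (fun ξ => ?_))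
  rw [Real.norm_eq_abs]
  exact hFb ξ

/-- ★★ **THE FIBRE-MEAN SQUARE KNIT** (exact identity, any centring constants `c₁ c₂ c₀`; see the module docstring). [folklore] -/
theorem fibreMean_secondDiff_eq (P : Measure Ω)
    (F₀₀ F₁₀ F₀₁ F₁₁ w₀₀ w₁₀ w₀₁ w₁₁ : Ω → ℝ) (M c₁ c₂ c₀ : ℝ)
    (hF₀₀ : AEStronglyMeasurable F₀₀ P) (hF₁₀ : AEStronglyMeasurable F₁₀ P)
    (hF₀₁ : AEStronglyMeasurable F₀₁ P) (hF₁₁ : AEStronglyMeasurable F₁₁ P)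
    (hb₀₀ : ∀ ξ, |F₀₀ ξ| ≤ M) (hb₁₀ : ∀ ξ, |F₁₀ ξ| ≤ M) (hb₀₁ : ∀ ξ, |F₀₁ ξ| ≤ M) (hb₁₁ : ∀ ξ, |F₁₁ ξ| ≤ M)
    (hw₀₀ : Integrable w₀₀ P) (hw₁₀ : Integrable w₁₀ P) (hw₀₁ : Integrable w₀₁ P) (hw₁₁ : Integrable w₁₁ P)
    (hn₀₀ : ∫ ξ, w₀₀ ξ ∂P = 1) (hn₁₀ : ∫ ξ, w₁₀ ξ ∂P = 1) (hn₀₁ : ∫ ξ, w₀₁ ξ ∂P = 1) (hn₁₁ : ∫ ξ, w₁₁ ξ ∂P = 1) :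
    (∫ ξ, F₁₁ ξ * w₁₁ ξ ∂P) - (∫ ξ, F₁₀ ξ * w₁₀ ξ ∂P) - (∫ ξ, F₀₁ ξ * w₀₁ ξ ∂P) + (∫ ξ, F₀₀ ξ * w₀₀ ξ ∂P)
      = (∫ ξ, (F₁₁ ξ - F₁₀ ξ - F₀₁ ξ + F₀₀ ξ) * w₁₁ ξ ∂P)
        + (∫ ξ, (F₁₀ ξ - F₀₀ ξ - c₁) * (w₁₁ ξ - w₁₀ ξ) ∂P)
        + (∫ ξ, (F₀₁ ξ - F₀₀ ξ - c₂) * (w₁₁ ξ - w₀₁ ξ) ∂P)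
        + (∫ ξ, (F₀₀ ξ - c₀) * (w₁₁ ξ - w₁₀ ξ - w₀₁ ξ + w₀₀ ξ) ∂P) := by
  -- integrability of all the products that occur
  have i11_11 := integrable_bdd_mul hF₁₁ hb₁₁ hw₁₁
  have i10_11 := integrable_bdd_mul hF₁₀ hb₁₀ hw₁₁
  have i10_10 := integrable_bdd_mul hF₁₀ hb₁₀ hw₁₀
  have i01_11 := integrable_bdd_mul hF₀₁ hb₀₁ hw₁₁
  have i01_01 := integrable_bdd_mul hF₀₁ hb₀₁ hw₀₁
  have i00_11 := integrable_bdd_mul hF₀₀ hb₀₀ hw₁₁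
  have i00_10 := integrable_bdd_mul hF₀₀ hb₀₀ hw₁₀
  have i00_01 := integrable_bdd_mul hF₀₀ hb₀₀ hw₀₁
  have i00_00 := integrable_bdd_mul hF₀₀ hb₀₀ hw₀₀
  -- expand the four right-hand integrals into elementary ones
  have e1 : (∫ ξ, (F₁₁ ξ - F₁₀ ξ - F₀₁ ξ + F₀₀ ξ) * w₁₁ ξ ∂P)
      = (∫ ξ, F₁₁ ξ * w₁₁ ξ ∂P) - (∫ ξ, F₁₀ ξ * w₁₁ ξ ∂P) - (∫ ξ, F₀₁ ξ * w₁₁ ξ ∂P) + (∫ ξ, F₀₀ ξ * w₁₁ ξ ∂P) := by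
    have h : (fun ξ => (F₁₁ ξ - F₁₀ ξ - F₀₁ ξ + F₀₀ ξ) * w₁₁ ξ)
        = fun ξ => ((F₁₁ ξ * w₁₁ ξ - F₁₀ ξ * w₁₁ ξ) - F₀₁ ξ * w₁₁ ξ) + F₀₀ ξ * w₁₁ ξ := by funext ξ; ring
    rw [h, integral_add ?_ i00_11, integral_sub ?_ i01_11, integral_sub i11_11 i10_11]
    · exact i11_11.sub i10_11
    · exact (i11_11.sub i10_11).sub i01_11
  have e2 : (∫ ξ, (F₁₀ ξ - F₀₀ ξ - c₁) * (w₁₁ ξ - w₁₀ ξ) ∂P)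
      = (∫ ξ, F₁₀ ξ * w₁₁ ξ ∂P) - (∫ ξ, F₁₀ ξ * w₁₀ ξ ∂P) - (∫ ξ, F₀₀ ξ * w₁₁ ξ ∂P) + (∫ ξ, F₀₀ ξ * w₁₀ ξ ∂P)
        - c₁ * ((∫ ξ, w₁₁ ξ ∂P) - (∫ ξ, w₁₀ ξ ∂P)) := by
    have h : (fun ξ => (F₁₀ ξ - F₀₀ ξ - c₁) * (w₁₁ ξ - w₁₀ ξ))
        = fun ξ => (((F₁₀ ξ * w₁₁ ξ - F₁₀ ξ * w₁₀ ξ) - F₀₀ ξ * w₁₁ ξ) + F₀₀ ξ * w₁₀ ξ) - c₁ * (w₁₁ ξ - w₁₀ ξ) := by funext ξ; ring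
    rw [h, integral_sub ?_ ?_, integral_add ?_ i00_10, integral_sub ?_ i00_11, integral_sub i10_11 i10_10,
      integral_const_mul, integral_sub hw₁₁ hw₁₀]
    · exact i10_11.sub i10_10
    · exact (i10_11.sub i10_10).sub i00_11
    · exact ((i10_11.sub i10_10).sub i00_11).add i00_10
    · exact (hw₁₁.sub hw₁₀).const_mul c₁
  have e3 : (∫ ξ, (F₀₁ ξ - F₀₀ ξ - c₂) * (w₁₁ ξ - w₀₁ ξ) ∂P)
      = (∫ ξ, F₀₁ ξ * w₁₁ ξ ∂P) - (∫ ξ, F₀₁ ξ * w₀₁ ξ ∂P) - (∫ ξ, F₀₀ ξ * w₁₁ ξ ∂P) + (∫ ξ, F₀₀ ξ * w₀₁ ξ ∂P)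
        - c₂ * ((∫ ξ, w₁₁ ξ ∂P) - (∫ ξ, w₀₁ ξ ∂P)) := by
    have h : (fun ξ => (F₀₁ ξ - F₀₀ ξ - c₂) * (w₁₁ ξ - w₀₁ ξ))
        = fun ξ => (((F₀₁ ξ * w₁₁ ξ - F₀₁ ξ * w₀₁ ξ) - F₀₀ ξ * w₁₁ ξ) + F₀₀ ξ * w₀₁ ξ) - c₂ * (w₁₁ ξ - w₀₁ ξ) := by funext ξ; ring
    rw [h, integral_sub ?_ ?_, integral_add ?_ i00_01, integral_sub ?_ i00_11, integral_sub i01_11 i01_01,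
      integral_const_mul, integral_sub hw₁₁ hw₀₁]
    · exact i01_11.sub i01_01
    · exact (i01_11.sub i01_01).sub i00_11
    · exact ((i01_11.sub i01_01).sub i00_11).add i00_01
    · exact (hw₁₁.sub hw₀₁).const_mul c₂
  have e4 : (∫ ξ, (F₀₀ ξ - c₀) * (w₁₁ ξ - w₁₀ ξ - w₀₁ ξ + w₀₀ ξ) ∂P)
      = (∫ ξ, F₀₀ ξ * w₁₁ ξ ∂P) - (∫ ξ, F₀₀ ξ * w₁₀ ξ ∂P) - (∫ ξ, F₀₀ ξ * w₀₁ ξ ∂P) + (∫ ξ, F₀₀ ξ * w₀₀ ξ ∂P)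
        - c₀ * ((∫ ξ, w₁₁ ξ ∂P) - (∫ ξ, w₁₀ ξ ∂P) - (∫ ξ, w₀₁ ξ ∂P) + (∫ ξ, w₀₀ ξ ∂P)) := by
    have h : (fun ξ => (F₀₀ ξ - c₀) * (w₁₁ ξ - w₁₀ ξ - w₀₁ ξ + w₀₀ ξ))
        = fun ξ => (((F₀₀ ξ * w₁₁ ξ - F₀₀ ξ * w₁₀ ξ) - F₀₀ ξ * w₀₁ ξ) + F₀₀ ξ * w₀₀ ξ) - c₀ * (((w₁₁ ξ - w₁₀ ξ) - w₀₁ ξ) + w₀₀ ξ) := by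
      funext ξ; ring
    rw [h, integral_sub ?_ ?_, integral_add ?_ i00_00, integral_sub ?_ i00_01, integral_sub i00_11 i00_10,
      integral_const_mul, integral_add ?_ hw₀₀, integral_sub ?_ hw₀₁, integral_sub hw₁₁ hw₁₀]
    · exact hw₁₁.sub hw₁₀
    · exact (hw₁₁.sub hw₁₀).sub hw₀₁
    · exact i00_11.sub i00_10
    · exact (i00_11.sub i00_10).sub i00_01
    · exact ((i00_11.sub i00_10).sub i00_01).add i00_00
    · exact (((hw₁₁.sub hw₁₀).sub hw₀₁).add hw₀₀).const_mul c₀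
  rw [e1, e2, e3, e4, hn₀₀, hn₁₀, hn₀₁, hn₁₁]
  ring

/-- ★ **TRIANGLE-INEQUALITY READING OF THE KNIT**: with sup bounds `|ΔΔF| ≤ A`, `|F₁₀ − F₀₀ − c₁| ≤ B₁`, `|F₀₁ − F₀₀ − c₂| ≤ B₂`, `|F₀₀ − c₀| ≤ B₀` and `ŵ₁₁ ≥ 0`:
`|ΔΔ m| ≤ A + B₁·∫|ŵ₁₁ − ŵ₁₀| + B₂·∫|ŵ₁₁ − ŵ₀₁| + B₀·∫|ŵ₁₁ − ŵ₁₀ − ŵ₀₁ + ŵ₀₀|` — the FOUR CHANNELS of LINᵘ-H's letters. [folklore] -/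
theorem abs_fibreMean_secondDiff_le (P : Measure Ω)
    (F₀₀ F₁₀ F₀₁ F₁₁ w₀₀ w₁₀ w₀₁ w₁₁ : Ω → ℝ) (M c₁ c₂ c₀ A B₁ B₂ B₀ : ℝ)
    (hF₀₀ : AEStronglyMeasurable F₀₀ P) (hF₁₀ : AEStronglyMeasurable F₁₀ P)
    (hF₀₁ : AEStronglyMeasurable F₀₁ P) (hF₁₁ : AEStronglyMeasurable F₁₁ P)
    (hb₀₀ : ∀ ξ, |F₀₀ ξ| ≤ M) (hb₁₀ : ∀ ξ, |F₁₀ ξ| ≤ M) (hb₀₁ : ∀ ξ, |F₀₁ ξ| ≤ M) (hb₁₁ : ∀ ξ, |F₁₁ ξ| ≤ M)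
    (hw₀₀ : Integrable w₀₀ P) (hw₁₀ : Integrable w₁₀ P) (hw₀₁ : Integrable w₀₁ P) (hw₁₁ : Integrable w₁₁ P)
    (hn₀₀ : ∫ ξ, w₀₀ ξ ∂P = 1) (hn₁₀ : ∫ ξ, w₁₀ ξ ∂P = 1) (hn₀₁ : ∫ ξ, w₀₁ ξ ∂P = 1) (hn₁₁ : ∫ ξ, w₁₁ ξ ∂P = 1)
    (hpos : ∀ ξ, 0 ≤ w₁₁ ξ)
    (hA : ∀ ξ, |F₁₁ ξ - F₁₀ ξ - F₀₁ ξ + F₀₀ ξ| ≤ A) (hB₁ : ∀ ξ, |F₁₀ ξ - F₀₀ ξ - c₁| ≤ B₁)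
    (hB₂ : ∀ ξ, |F₀₁ ξ - F₀₀ ξ - c₂| ≤ B₂) (hB₀ : ∀ ξ, |F₀₀ ξ - c₀| ≤ B₀) :
    |(∫ ξ, F₁₁ ξ * w₁₁ ξ ∂P) - (∫ ξ, F₁₀ ξ * w₁₀ ξ ∂P) - (∫ ξ, F₀₁ ξ * w₀₁ ξ ∂P) + (∫ ξ, F₀₀ ξ * w₀₀ ξ ∂P)|
      ≤ A + B₁ * (∫ ξ, |w₁₁ ξ - w₁₀ ξ| ∂P) + B₂ * (∫ ξ, |w₁₁ ξ - w₀₁ ξ| ∂P) + B₀ * (∫ ξ, |w₁₁ ξ - w₁₀ ξ - w₀₁ ξ + w₀₀ ξ| ∂P) := by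
  rw [fibreMean_secondDiff_eq P F₀₀ F₁₀ F₀₁ F₁₁ w₀₀ w₁₀ w₀₁ w₁₁ M c₁ c₂ c₀ hF₀₀ hF₁₀ hF₀₁ hF₁₁ hb₀₀ hb₁₀ hb₀₁ hb₁₁
    hw₀₀ hw₁₀ hw₀₁ hw₁₁ hn₀₀ hn₁₀ hn₀₁ hn₁₁]
  -- term 1: |∫ ΔΔF · w₁₁| ≤ A · ∫ w₁₁ = A
  have t1 : |∫ ξ, (F₁₁ ξ - F₁₀ ξ - F₀₁ ξ + F₀₀ ξ) * w₁₁ ξ ∂P| ≤ A := by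
    have hle : ∀ ξ, |(F₁₁ ξ - F₁₀ ξ - F₀₁ ξ + F₀₀ ξ) * w₁₁ ξ| ≤ A * w₁₁ ξ := fun ξ => by
      rw [abs_mul, abs_of_nonneg (hpos ξ)]
      exact mul_le_mul_of_nonneg_right (hA ξ) (hpos ξ)
    calc |∫ ξ, (F₁₁ ξ - F₁₀ ξ - F₀₁ ξ + F₀₀ ξ) * w₁₁ ξ ∂P|
        ≤ ∫ ξ, |(F₁₁ ξ - F₁₀ ξ - F₀₁ ξ + F₀₀ ξ) * w₁₁ ξ| ∂P := by
          simpa only [Real.norm_eq_abs] using norm_integral_le_integral_norm (fun ξ => (F₁₁ ξ - F₁₀ ξ - F₀₁ ξ + F₀₀ ξ) * w₁₁ ξ)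
      _ ≤ ∫ ξ, A * w₁₁ ξ ∂P := by
          refine integral_mono_of_nonneg (Filter.Eventually.of_forall (fun ξ => abs_nonneg _)) (hw₁₁.const_mul A)
            (Filter.Eventually.of_forall hle)
      _ = A := by rw [integral_const_mul, hn₁₁, mul_one]
  -- generic: |∫ G · u| ≤ B · ∫ |u| when |G| ≤ B pointwise and u integrable
  have gen : ∀ (G u : Ω → ℝ) (B : ℝ), Integrable u P → (∀ ξ, |G ξ| ≤ B) →
      |∫ ξ, G ξ * u ξ ∂P| ≤ B * ∫ ξ, |u ξ| ∂P := by
    intro G u B hu hG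
    have hle : ∀ ξ, |G ξ * u ξ| ≤ B * |u ξ| := fun ξ => by
      rw [abs_mul]; exact mul_le_mul_of_nonneg_right (hG ξ) (abs_nonneg _)
    calc |∫ ξ, G ξ * u ξ ∂P|
        ≤ ∫ ξ, |G ξ * u ξ| ∂P := by
          simpa only [Real.norm_eq_abs] using norm_integral_le_integral_norm (fun ξ => G ξ * u ξ)
      _ ≤ ∫ ξ, B * |u ξ| ∂P := by
          refine integral_mono_of_nonneg (Filter.Eventually.of_forall (fun ξ => abs_nonneg _)) (hu.abs.const_mul B)
            (Filter.Eventually.of_forall hle)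
      _ = B * ∫ ξ, |u ξ| ∂P := integral_const_mul _ _
  have t2 := gen (fun ξ => F₁₀ ξ - F₀₀ ξ - c₁) (fun ξ => w₁₁ ξ - w₁₀ ξ) B₁ (hw₁₁.sub hw₁₀) hB₁
  have t3 := gen (fun ξ => F₀₁ ξ - F₀₀ ξ - c₂) (fun ξ => w₁₁ ξ - w₀₁ ξ) B₂ (hw₁₁.sub hw₀₁) hB₂
  have t4 := gen (fun ξ => F₀₀ ξ - c₀) (fun ξ => w₁₁ ξ - w₁₀ ξ - w₀₁ ξ + w₀₀ ξ) B₀ (((hw₁₁.sub hw₁₀).sub hw₀₁).add hw₀₀) hB₀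
  calc |(∫ ξ, (F₁₁ ξ - F₁₀ ξ - F₀₁ ξ + F₀₀ ξ) * w₁₁ ξ ∂P)
        + (∫ ξ, (F₁₀ ξ - F₀₀ ξ - c₁) * (w₁₁ ξ - w₁₀ ξ) ∂P)
        + (∫ ξ, (F₀₁ ξ - F₀₀ ξ - c₂) * (w₁₁ ξ - w₀₁ ξ) ∂P)
        + (∫ ξ, (F₀₀ ξ - c₀) * (w₁₁ ξ - w₁₀ ξ - w₀₁ ξ + w₀₀ ξ) ∂P)|
      ≤ |∫ ξ, (F₁₁ ξ - F₁₀ ξ - F₀₁ ξ + F₀₀ ξ) * w₁₁ ξ ∂P|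
        + |∫ ξ, (F₁₀ ξ - F₀₀ ξ - c₁) * (w₁₁ ξ - w₁₀ ξ) ∂P|
        + |∫ ξ, (F₀₁ ξ - F₀₀ ξ - c₂) * (w₁₁ ξ - w₀₁ ξ) ∂P|
        + |∫ ξ, (F₀₀ ξ - c₀) * (w₁₁ ξ - w₁₀ ξ - w₀₁ ξ + w₀₀ ξ) ∂P| := by
          refine le_trans (abs_add_le _ _) (add_le_add (le_trans (abs_add_le _ _) (add_le_add (abs_add_le _ _) le_rfl)) le_rfl)
    _ ≤ A + B₁ * (∫ ξ, |w₁₁ ξ - w₁₀ ξ| ∂P) + B₂ * (∫ ξ, |w₁₁ ξ - w₀₁ ξ| ∂P) + B₀ * (∫ ξ, |w₁₁ ξ - w₁₀ ξ - w₀₁ ξ + w₀₀ ξ| ∂P) :=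
          add_le_add (add_le_add (add_le_add t1 t2) t3) t4

end Summit.QuantumFields.YangMills.Theorems.OrganTangentFibreMeanSquareKnit

end
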